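import Literature.AlgebraicGeometry.Resolution.SpreadRestrict
import Literature.AlgebraicGeometry.Resolution.SpreadModelTower
import Literature.AlgebraicGeometry.Resolution.CanonicalResolutionSpread
import Literature.AlgebraicGeometry.Resolution.EffectiveResolutionCharZeroReduction
import Literature.AlgebraicGeometry.Resolution.RegularLocusPerfectFibreScheme
import Literature.RingTheory.Flat.GenericFreenessProofs
import Mathlib.RingTheory.Localization.BaseChange
import Mathlib.RingTheory.Flat.Localization
import HarnessLib

/-!
# The model of the zero scheme and the image of its non-smooth locus

Topic: `Literature/AlgebraicGeometry/Resolution`. Input for clause (ii) of the spreading-out step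
`SpreadsShapedFromGenericPoint` (`CanonicalResolutionSpread.lean`; BGMW 2011, Thm. 8.0.5 (2) with
Cor. 8.0.6–8.0.7: "the smooth locus of `Y/B` specializing to the regular locus over a perfect
field"). For a ring `A` and `f : ℤ[c] → A` let `F = univFamily f ⊆ A[x₁, …, xₙ]` be the
specialized universal family, `Y_A = Spec (A[x]/(F)) ↪ 𝔸ⁿ_A` its zero scheme (`modelZeroLocus`,
`modelZeroLocusι`) over `Spec A` (`modelZeroLocusToSpec`), and

  `Z_A = ι(Y_A ∖ Sm(Y_A / A)) ⊆ 𝔸ⁿ_A`  (`modelSingLocus`),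

the image of the non-smooth locus of `Y_A → Spec A`, a CLOSED subset (`isClosed_modelSingLocus`).
At a field-valued point `φ : A → k` the fibre of `Y_A` is the zero scheme
`affineZeroLocus k n (univFamily (φ ∘ f)) = Spec (k[x]/(F_φ))` of the statement, and:

* `isPullback_specMap_mvPolynomial_map` — `𝔸ⁿ_B = 𝔸ⁿ_A ×_A Spec B` (the cartesian square of
  `Spec` of the polynomial base change); `comap_idealSheaf_span_univFamily`,
  `ker_affineZeroLocusι_univFamily` — the ideal sheaf of `V(F)` pulls back along `𝔸ⁿ_B → 𝔸ⁿ_A`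
  to the ideal sheaf of `V(F_B)`;
* `isPullback_modelZeroLocusMap_ι`, `isPullback_modelZeroLocusMap` — the squares
  `(V(F_φ) ↪ 𝔸ⁿ_k, V(F_φ) → Y_A, 𝔸ⁿ_k → 𝔸ⁿ_A, Y_A ↪ 𝔸ⁿ_A)` and
  `(V(F_φ) → Y_A, V(F_φ) → Spec k, Y_A → Spec A, Spec k → Spec A)` are cartesian (Mathlib's
  `isPullback_of_isClosedImmersion`: the ideal sheaf of `(F)` pulls back to that of `(F_φ)`);
* `exists_flat_preimage_basicOpen` — **generic flatness** (Görtz–Wedhorn I, Thm. 10.83, the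
  tree's `GortzWedhorn2020_10_83_holds`): for `A` a Noetherian domain and `B` of finite type,
  `Spec B → Spec A` is flat over some `D(b)`, `b ≠ 0`; `exists_flat_modelZeroLocusToSpec`;
* `isRegularLocalRing_stalk_iff_not_mem_modelSingLocus` — **for `Y_A` flat over `D(b)`, `k`
  PERFECT and `φ(b) ≠ 0`, a point `y` of `V(F_φ)` has a regular local ring iff its image in
  `𝔸ⁿ_A` does not lie in `Z_A`** (`RegularLocusPerfectFibreScheme.lean`: the regular locus of a
  perfect-field-valued fibre of a flat family of finite presentation is the preimage of the
  smooth locus, Stacks 038X/00TF/056S);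
* `exists_eq_of_specMap_mem_range_modelZeroLocusι` — points of `𝔸ⁿ_k` over `ι(Y_A)` (in
  particular over `Z_A`) are points of `V(F_φ)`.

## Sources

* E. Bierstone, D. Grigoriev, P. Milman, J. Włodarczyk, arXiv:1206.3090, Thm. 8.0.5 (2),
  Cor. 8.0.6–8.0.7. [BierstoneGrigorievMilmanWlodarczyk2011]
* U. Görtz, T. Wedhorn, *Algebraic Geometry I*, 2nd ed. (2020), Thm. 10.83. [GortzWedhorn2020]
* The Stacks Project, Tags 038X, 00TF, 056S. [StacksProject]
-/

noncomputable section

open CategoryTheory CategoryTheory.Limits AlgebraicGeometry TopologicalSpace MvPolynomial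
  PrimeSpectrum

namespace Literature.AlgebraicGeometry.Resolution

open Scheme.IdealSheafData

attribute [local instance] MvPolynomial.algebraMvPolynomial

/-! ## Affine spaces under base change, and the ideal sheaf of the universal family -/

section AffineSpace

variable {n : ℕ}

/-- **`𝔸ⁿ_B = 𝔸ⁿ_A ×_{Spec A} Spec B`**: for an `A`-algebra `B`, the square
`(Spec B[x] → Spec A[x], Spec B[x] → Spec B, Spec A[x] → Spec A, Spec B → Spec A)` is cartesian.
[folklore] -/
theorem isPullback_specMap_mvPolynomial_map (A B : Type) [CommRing A] [CommRing B] [Algebra A B] :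
    IsPullback (Spec.map (CommRingCat.ofHom (MvPolynomial.map (σ := Fin n) (algebraMap A B))))
      (Spec.map (CommRingCat.ofHom (algebraMap B (MvPolynomial (Fin n) B))))
      (Spec.map (CommRingCat.ofHom (algebraMap A (MvPolynomial (Fin n) A))))
      (specOfAlgebra A B) := by
  have h := isPullback_SpecMap_of_isPushout _ _ _ _
    (CommRingCat.isPushout_of_isPushout A B (MvPolynomial (Fin n) A) (MvPolynomial (Fin n) B))
  have e : algebraMap (MvPolynomial (Fin n) A) (MvPolynomial (Fin n) B) =
      MvPolynomial.map (algebraMap A B) := rfl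
  rw [e] at h
  exact h.flip

variable {d l : ℕ}

/-- **The ideal sheaf of `V(F)` pulls back to the ideal sheaf of `V(F_B)`** along
`𝔸ⁿ_B → 𝔸ⁿ_A`, for the universal family specialized along `f : ℤ[c] → A` and further along
`g : A → B`. [folklore] -/
theorem comap_idealSheaf_span_univFamily {A B : Type} [CommRing A] [CommRing B]
    (f : CoeffRing n d l →+* A) (g : A →+* B) :
    (affineBlowup.idealSheaf (Ideal.span (univFamily n d l f : Set (MvPolynomial (Fin n) A)))).comap
        (Spec.map (CommRingCat.ofHom (MvPolynomial.map g))) =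
      affineBlowup.idealSheaf (Ideal.span (univFamily n d l (g.comp f) : Set (MvPolynomial (Fin n) B))) := by
  classical
  rw [affineBlowup.comap_idealSheaf_specMap, Ideal.map_span, univFamily_comp, Finset.coe_image]

/-- The ideal sheaf of `V(S) ↪ 𝔸ⁿ_k` is the ideal sheaf of `(S)`. [folklore] -/
theorem ker_affineZeroLocusι_eq_idealSheaf (k : Type) [Field k] (S : Finset (MvPolynomial (Fin n) k)) :
    (affineZeroLocusι k n S).ker = affineBlowup.idealSheaf (Ideal.span (S : Set (MvPolynomial (Fin n) k))) :=
  ker_specMap_quotient_mk _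

/-- **The ideal sheaf of `V(F_φ) ↪ 𝔸ⁿ_k` is the pull-back of the ideal sheaf of `(F)` on `𝔸ⁿ_A`**
along `𝔸ⁿ_k → 𝔸ⁿ_A`, for `φ : A → k`. [folklore] -/
theorem ker_affineZeroLocusι_univFamily {A : Type} [CommRing A] (f : CoeffRing n d l →+* A)
    (k : Type) [Field k] (φ : A →+* k) :
    (affineZeroLocusι k n (univFamily n d l (φ.comp f))).ker =
      (affineBlowup.idealSheaf (Ideal.span (univFamily n d l f : Set (MvPolynomial (Fin n) A)))).comap
        (Spec.map (CommRingCat.ofHom (MvPolynomial.map φ))) := by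
  rw [ker_affineZeroLocusι_eq_idealSheaf, comap_idealSheaf_span_univFamily]

end AffineSpace

/-! ## Generic flatness, scheme form -/

section GenericFlatness

open Literature.RingTheory.Flat

/-- **Generic flatness** (Görtz–Wedhorn I, Thm. 10.83 / EGA IV₂ 6.9.1): for a Noetherian domain
`A` and an `A`-algebra `B` of finite type there is `b ≠ 0` such that `Spec B → Spec A` is flat
over `D(b)` — `B[1/b]` is a flat `A`-module (`GortzWedhorn2020_10_83_holds`), `Spec B[1/b]` is the
preimage of `D(b)`. [cite: GortzWedhorn2020, Thm. 10.83] -/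
theorem exists_flat_preimage_basicOpen (A B : Type) [CommRing A] [IsDomain A] [IsNoetherianRing A]
    [CommRing B] [Algebra A B] [Algebra.FiniteType A B] :
    ∃ b : A, b ≠ 0 ∧ Flat (((Spec.map (CommRingCat.ofHom (algebraMap A B))) ⁻¹ᵁ basicOpen b).ι ≫
      Spec.map (CommRingCat.ofHom (algebraMap A B))) := by
  obtain ⟨b, hb, hflat⟩ := GortzWedhorn2020_10_83.flat_localizedModule_base
    GortzWedhorn2020_10_83_holds A B B inferInstance inferInstance
  refine ⟨b, hb, ?_⟩
  set g : Spec (CommRingCat.of B) ⟶ Spec (.of A) := Spec.map (CommRingCat.ofHom (algebraMap A B))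
    with hg
  -- `B' = B[1/b]` is flat over `A`
  set r : B := algebraMap A B b with hr
  haveI : IsLocalization (Algebra.algebraMapSubmonoid B (Submonoid.powers b)) (Localization.Away r) := by
    rw [Algebra.algebraMapSubmonoid_powers]
    infer_instance
  have hloc : IsLocalizedModule (Submonoid.powers b)
      (IsScalarTower.toAlgHom A B (Localization.Away r)).toLinearMap :=
    (isLocalizedModule_iff_isLocalization).mpr inferInstance
  haveI : Module.Flat A (Localization.Away r) :=
    Module.Flat.of_linearEquiv (IsLocalizedModule.iso (Submonoid.powers b)
      (IsScalarTower.toAlgHom A B (Localization.Away r)).toLinearMap).symm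
  have hF : Flat (Spec.map (CommRingCat.ofHom (algebraMap A (Localization.Away r)))) := by
    rw [Flat.SpecMap_iff, CommRingCat.hom_ofHom]
    exact RingHom.flat_algebraMap_iff.mpr inferInstance
  -- `Spec B' → Spec B` is an open immersion with image the preimage of `D(b)`
  set u : Spec (CommRingCat.of (Localization.Away r)) ⟶ Spec (CommRingCat.of B) :=
    Spec.map (CommRingCat.ofHom (algebraMap B (Localization.Away r))) with hu
  haveI : IsOpenImmersion u := IsOpenImmersion.of_isLocalization r
  have hrange : Set.range u = Set.range (g ⁻¹ᵁ basicOpen b).ι := by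
    rw [Scheme.Opens.range_ι]
    have h1 : Set.range u = (basicOpen r : Set (PrimeSpectrum B)) := by
      rw [← localization_away_comap_range (Localization.Away r) r]
      rfl
    rw [h1]
    ext x
    show x ∈ basicOpen r ↔ g x ∈ basicOpen b
    rw [hg, Spec.map_apply, CommRingCat.hom_ofHom]
    rfl
  have hfac : (IsOpenImmersion.isoOfRangeEq u (g ⁻¹ᵁ basicOpen b).ι hrange).hom ≫
      ((g ⁻¹ᵁ basicOpen b).ι ≫ g) =
        Spec.map (CommRingCat.ofHom (algebraMap A (Localization.Away r))) := by
    rw [← Category.assoc, IsOpenImmersion.isoOfRangeEq_hom_fac, hu, hg, ← Spec.map_comp,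
      ← CommRingCat.ofHom_comp, ← IsScalarTower.algebraMap_eq]
  have hfac' : (g ⁻¹ᵁ basicOpen b).ι ≫ g =
      (IsOpenImmersion.isoOfRangeEq u (g ⁻¹ᵁ basicOpen b).ι hrange).inv ≫
        Spec.map (CommRingCat.ofHom (algebraMap A (Localization.Away r))) := by
    rw [← hfac, Iso.inv_hom_id_assoc]
  rw [hfac']
  haveI := hF
  infer_instance

end GenericFlatness

/-! ## The model `Y_A ↪ 𝔸ⁿ_A` of the zero scheme and its non-smooth locus -/

section Model

variable {n d l : ℕ} {A : Type} [CommRing A] (f : CoeffRing n d l →+* A)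

/-- The ideal `(F) ⊆ A[x₁, …, xₙ]` of the universal family specialized along `f : ℤ[c] → A`.
[cite: BierstoneGrigorievMilmanWlodarczyk2011, §8 (proof of Cor. 8.0.6)] -/
abbrev univIdeal : Ideal (MvPolynomial (Fin n) A) :=
  Ideal.span (univFamily n d l f : Set (MvPolynomial (Fin n) A))

/-- **The model `Y_A = Spec (A[x]/(F))`** of the zero schemes `V(F_φ)`; for `A = k` a field it is
`affineZeroLocus k n F` on the nose. [cite: BierstoneGrigorievMilmanWlodarczyk2011, §8 (proof of Cor. 8.0.6)] -/
abbrev modelZeroLocus : Scheme.{0} :=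
  Spec (CommRingCat.of (MvPolynomial (Fin n) A ⧸ univIdeal f))

/-- The closed immersion `Y_A ↪ 𝔸ⁿ_A`. [folklore] -/
def modelZeroLocusι : modelZeroLocus f ⟶ Spec (CommRingCat.of (MvPolynomial (Fin n) A)) :=
  Spec.map (CommRingCat.ofHom (Ideal.Quotient.mk (univIdeal f)))

/-- `Y_A ↪ 𝔸ⁿ_A` is a closed immersion. [folklore] -/
instance isClosedImmersion_modelZeroLocusι : IsClosedImmersion (modelZeroLocusι f) := by
  delta modelZeroLocusι modelZeroLocus
  exact IsClosedImmersion.spec_of_surjective _ Ideal.Quotient.mk_surjective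

/-- The structure morphism `Y_A → Spec A` (through `𝔸ⁿ_A`). [folklore] -/
def modelZeroLocusToSpec : modelZeroLocus f ⟶ Spec (.of A) :=
  modelZeroLocusι f ≫ Spec.map (CommRingCat.ofHom (algebraMap A (MvPolynomial (Fin n) A)))

/-- `Y_A → Spec A` is `Spec` of the algebra map. [folklore] -/
theorem modelZeroLocusToSpec_eq : modelZeroLocusToSpec f =
    Spec.map (CommRingCat.ofHom (algebraMap A (MvPolynomial (Fin n) A ⧸ univIdeal f))) := by
  rw [modelZeroLocusToSpec, modelZeroLocusι, ← Spec.map_comp, ← CommRingCat.ofHom_comp]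

/-- `Y_A → Spec A` is locally of finite presentation (`A` Noetherian). [folklore] -/
instance locallyOfFinitePresentation_modelZeroLocusToSpec [IsNoetherianRing A] :
    LocallyOfFinitePresentation (modelZeroLocusToSpec f) := by
  rw [modelZeroLocusToSpec_eq, HasRingHomProperty.Spec_iff (P := @LocallyOfFinitePresentation)]
  haveI : Algebra.FinitePresentation A (MvPolynomial (Fin n) A ⧸ univIdeal f) :=
    Algebra.FinitePresentation.of_finiteType.mp inferInstance
  exact RingHom.finitePresentation_algebraMap.mpr inferInstance

/-- `Y_A → Spec A` is locally of finite type. [folklore] -/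
instance locallyOfFiniteType_modelZeroLocusToSpec :
    LocallyOfFiniteType (modelZeroLocusToSpec f) := by
  rw [modelZeroLocusToSpec_eq, HasRingHomProperty.Spec_iff (P := @LocallyOfFiniteType)]
  exact RingHom.finiteType_algebraMap.mpr inferInstance

/-- **`Z_A ⊆ 𝔸ⁿ_A`: the image of the non-smooth locus of `Y_A → Spec A`** (the stalkwise form of
the complement of Mathlib's `Scheme.Hom.smoothLocus`, so that no instance is needed to state it).
[cite: BierstoneGrigorievMilmanWlodarczyk2011, Thm. 8.0.5 (2) with Cor. 8.0.6–8.0.7] -/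
def modelSingLocus : Set (Spec (CommRingCat.of (MvPolynomial (Fin n) A))) :=
  modelZeroLocusι f '' {y | ¬ ((modelZeroLocusToSpec f).stalkMap y).hom.FormallySmooth}

/-- `Z_A ⊆ ι(Y_A)`. [folklore] -/
theorem modelSingLocus_subset_range : modelSingLocus f ⊆ Set.range (modelZeroLocusι f) :=
  Set.image_subset_range _ _

/-- **`Z_A` is closed** (`A` Noetherian: the smooth locus is open, the immersion is closed).
[folklore] -/
theorem isClosed_modelSingLocus [IsNoetherianRing A] : IsClosed (modelSingLocus f) := by
  refine (modelZeroLocusι f).isClosedEmbedding.isClosedMap _ ?_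
  have h : {y : modelZeroLocus f | ¬ ((modelZeroLocusToSpec f).stalkMap y).hom.FormallySmooth} =
      ((modelZeroLocusToSpec f).smoothLocus : Set (modelZeroLocus f))ᶜ := by
    ext y
    rfl
  rw [h]
  exact (modelZeroLocusToSpec f).smoothLocus.isOpen.isClosed_compl

/-- Membership in `Z_A` of the image of a point of `Y_A`. [folklore] -/
theorem apply_mem_modelSingLocus_iff [IsNoetherianRing A] (y : modelZeroLocus f) :
    modelZeroLocusι f y ∈ modelSingLocus f ↔ y ∉ (modelZeroLocusToSpec f).smoothLocus := by
  constructor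
  · rintro ⟨y', hy', he⟩
    rw [(modelZeroLocusι f).isClosedEmbedding.injective he] at hy'
    exact hy'
  · intro hy
    exact ⟨y, hy, rfl⟩

/-- The image of `Y_A ↪ 𝔸ⁿ_A` is `V((F))`. [folklore] -/
theorem range_modelZeroLocusι :
    Set.range (modelZeroLocusι f) = zeroLocus (univIdeal f : Set (MvPolynomial (Fin n) A)) := by
  have h : Set.range (modelZeroLocusι f) =
      Set.range (PrimeSpectrum.comap (Ideal.Quotient.mk (univIdeal f))) := by
    congr 1
  rw [h, range_comap_of_surjective _ _ Ideal.Quotient.mk_surjective, Ideal.mk_ker]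

/-- **Generic flatness of the model**: `Y_A → Spec A` is flat over some `D(b)`, `b ≠ 0`, for `A`
a Noetherian domain. [cite: GortzWedhorn2020, Thm. 10.83] -/
theorem exists_flat_modelZeroLocusToSpec [IsDomain A] [IsNoetherianRing A] :
    ∃ b : A, b ≠ 0 ∧
      Flat (((modelZeroLocusToSpec f) ⁻¹ᵁ basicOpen b).ι ≫ modelZeroLocusToSpec f) := by
  rw [modelZeroLocusToSpec_eq]
  exact exists_flat_preimage_basicOpen A (MvPolynomial (Fin n) A ⧸ univIdeal f)

/-! ## The fibres: `V(F_φ) = Y_A ×_{Spec A} Spec k` -/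

variable (k : Type) [Field k] (φ : A →+* k)

/-- `(F) ⊆ (F_φ)` along `A[x] → k[x]`. [folklore] -/
theorem univIdeal_le_comap :
    univIdeal f ≤ (Ideal.span (univFamily n d l (φ.comp f) : Set (MvPolynomial (Fin n) k))).comap
      (MvPolynomial.map φ) := by
  classical
  rw [← Ideal.map_le_iff_le_comap, Ideal.map_span, univFamily_comp, Finset.coe_image]

/-- The morphism `V(F_φ) → Y_A` of the fibre at `φ : A → k`. [folklore] -/
def modelZeroLocusMap : affineZeroLocus k n (univFamily n d l (φ.comp f)) ⟶ modelZeroLocus f :=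
  Spec.map (CommRingCat.ofHom (Ideal.quotientMap
    (Ideal.span (univFamily n d l (φ.comp f) : Set (MvPolynomial (Fin n) k))) (MvPolynomial.map φ)
    (univIdeal_le_comap f k φ)))

/-- Compatibility with the embeddings into the affine spaces. [folklore] -/
theorem modelZeroLocusMap_ι : modelZeroLocusMap f k φ ≫ modelZeroLocusι f =
    affineZeroLocusι k n (univFamily n d l (φ.comp f)) ≫
      Spec.map (CommRingCat.ofHom (MvPolynomial.map φ)) := by
  delta modelZeroLocusMap modelZeroLocusι affineZeroLocusι affineZeroLocus
  rw [← Spec.map_comp, ← Spec.map_comp, ← CommRingCat.ofHom_comp, ← CommRingCat.ofHom_comp,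
    Ideal.quotientMap_comp_mk]

/-- The image of a point of the fibre in `𝔸ⁿ_A`. [folklore] -/
theorem specMap_affineZeroLocusι_apply (y : affineZeroLocus k n (univFamily n d l (φ.comp f))) :
    Spec.map (CommRingCat.ofHom (MvPolynomial.map φ))
        (affineZeroLocusι k n (univFamily n d l (φ.comp f)) y) =
      modelZeroLocusι f (modelZeroLocusMap f k φ y) := by
  rw [← Scheme.Hom.comp_apply, ← Scheme.Hom.comp_apply, modelZeroLocusMap_ι]

/-- The ideal sheaf of `Y_A ↪ 𝔸ⁿ_A`. [folklore] -/
theorem ker_modelZeroLocusι : (modelZeroLocusι f).ker = affineBlowup.idealSheaf (univIdeal f) :=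
  ker_specMap_quotient_mk _

/-- **The square `(V(F_φ) ↪ 𝔸ⁿ_k, V(F_φ) → Y_A, 𝔸ⁿ_k → 𝔸ⁿ_A, Y_A ↪ 𝔸ⁿ_A)` is cartesian.**
[folklore] -/
theorem isPullback_modelZeroLocusMap_ι :
    IsPullback (affineZeroLocusι k n (univFamily n d l (φ.comp f))) (modelZeroLocusMap f k φ)
      (Spec.map (CommRingCat.ofHom (MvPolynomial.map φ))) (modelZeroLocusι f) :=
  isPullback_of_isClosedImmersion _ _ _ _ (modelZeroLocusMap_ι f k φ).symm (by
    rw [ker_modelZeroLocusι, comap_idealSheaf_span_univFamily, ker_affineZeroLocusι_eq_idealSheaf])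

/-- **The square `(V(F_φ) → Y_A, V(F_φ) → Spec k, Y_A → Spec A, Spec k → Spec A)` is
cartesian.** [folklore] -/
theorem isPullback_modelZeroLocusMap :
    IsPullback (modelZeroLocusMap f k φ)
      (affineZeroLocusι k n (univFamily n d l (φ.comp f)) ≫
        Spec.map (CommRingCat.ofHom (algebraMap k (MvPolynomial (Fin n) k))))
      (modelZeroLocusToSpec f) (Spec.map (CommRingCat.ofHom φ)) := by
  letI : Algebra A k := φ.toAlgebra
  have hφalg : (algebraMap A k : A →+* k) = φ := rfl
  have HX : IsPullback (Spec.map (CommRingCat.ofHom (MvPolynomial.map (σ := Fin n) φ)))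
      (Spec.map (CommRingCat.ofHom (algebraMap k (MvPolynomial (Fin n) k))))
      (Spec.map (CommRingCat.ofHom (algebraMap A (MvPolynomial (Fin n) A))))
      (Spec.map (CommRingCat.ofHom φ)) := by
    have h := isPullback_specMap_mvPolynomial_map (n := n) A k
    rwa [hφalg] at h
  exact (isPullback_modelZeroLocusMap_ι f k φ).flip.paste_vert HX

/-- **Points of `𝔸ⁿ_k` over `ι(Y_A)` are points of `V(F_φ)`.** [folklore] -/
theorem exists_eq_of_specMap_mem_range_modelZeroLocusι
    (u : ↥(Spec (CommRingCat.of (MvPolynomial (Fin n) k))))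
    (hu : Spec.map (CommRingCat.ofHom (MvPolynomial.map φ)) u ∈ Set.range (modelZeroLocusι f)) :
    ∃ y : affineZeroLocus k n (univFamily n d l (φ.comp f)),
      affineZeroLocusι k n (univFamily n d l (φ.comp f)) y = u := by
  obtain ⟨y', hy'⟩ := hu
  obtain ⟨y, hy₁, -⟩ := Scheme.Pullback.exists_preimage_pullback u y' hy'.symm
  refine ⟨(isPullback_modelZeroLocusMap_ι f k φ).isoPullback.inv y, ?_⟩
  rw [← Scheme.Hom.comp_apply, IsPullback.isoPullback_inv_fst]
  exact hy₁

/-- **Regular points of the fibre versus `Z_A`.** Let `Y_A → Spec A` be flat over `D(b)`, `k` a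
perfect field and `φ : A → k` with `φ(b) ≠ 0`. Then a point `y` of `V(F_φ)` has a regular local
ring iff its image in `𝔸ⁿ_A` does not lie in `Z_A` (the regular locus of the perfect-field-valued
fibre of a flat family of finite presentation is the preimage of the smooth locus).
[cite: StacksProject, Tag 038X with Tags 00TF, 056S] -/
theorem isRegularLocalRing_stalk_iff_not_mem_modelSingLocus [IsNoetherianRing A] {b : A}
    (hb : Flat (((modelZeroLocusToSpec f) ⁻¹ᵁ basicOpen b).ι ≫ modelZeroLocusToSpec f))
    [PerfectField k] (hφ : φ b ≠ 0) (y : affineZeroLocus k n (univFamily n d l (φ.comp f))) :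
    IsRegularLocalRing ((affineZeroLocus k n (univFamily n d l (φ.comp f))).presheaf.stalk y) ↔
      Spec.map (CommRingCat.ofHom (MvPolynomial.map φ))
        (affineZeroLocusι k n (univFamily n d l (φ.comp f)) y) ∉ modelSingLocus f := by
  set gY := modelZeroLocusToSpec f with hgY
  -- the fibre lies over `D(b)`, in a cartesian square with the flat restriction
  obtain ⟨ι₀, hι₀, H₀⟩ := exists_lift_isPullback_of_apply_ne_zero gY b φ hφ
    (isPullback_modelZeroLocusMap f k φ)
  haveI := hb
  letI : Algebra A k := φ.toAlgebra
  have H₀' : IsPullback ι₀ (affineZeroLocusι k n (univFamily n d l (φ.comp f)) ≫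
      Spec.map (CommRingCat.ofHom (algebraMap k (MvPolynomial (Fin n) k))))
      ((gY ⁻¹ᵁ basicOpen b).ι ≫ gY) (specOfAlgebra A k) := H₀
  rw [isRegularLocalRing_stalk_iff_mem_smoothLocus_of_isPullback k ((gY ⁻¹ᵁ basicOpen b).ι ≫ gY)
    H₀' y, ← Scheme.Hom.preimage_smoothLocus_eq, specMap_affineZeroLocusι_apply,
    apply_mem_modelSingLocus_iff, not_not]
  have e1 : (gY ⁻¹ᵁ basicOpen b).ι (ι₀ y) = modelZeroLocusMap f k φ y := by
    rw [← Scheme.Hom.comp_apply, hι₀]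
  show (gY ⁻¹ᵁ basicOpen b).ι (ι₀ y) ∈ gY.smoothLocus ↔ _
  rw [e1]

end Model

end Literature.AlgebraicGeometry.Resolution

end
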